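import Summits.BirchSwinnertonDyer.BirchSwinnertonDyer.Theorems.PrintCf2RubinValueTwoRowTwoTwistedKummerClass
import Literature.NumberTheory.GaloisRepresentations.RootsOfUnityInverseLimit
import HarnessLib

/-!
# M-LINE-PIN / (α3) ROW 2, FILE 3c: LAWS of the twisted Kummer classes — multiplicativity in `β` and the reduction law `k+1 → k`
# (root `β ↦ β^p`)

Cell `bsd-print-cf2`, WIDTH seat `bsd-line-cf2-p1-w6` g8 (prover-bsd-line-cf2-p1-w6-g8-0); (α3) ROW 2 on the DECIDING child stmt-BirchSwinnertonDyer-24721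
(memo `HOME/bsd-line-cf2-p1-w6/ROW2-SPEC-w6g8.md`; hypotheses `hmul`, `hredk` of `RowTwo.exists_lift`); `--supports` that item (helper, Theses-free).
HONEST FRAMING: cohomological bookkeeping; nothing about BSD. THEOREMS ONLY.

* `isTwistedKummerClass_mul` — classes of `β`, `β'` ⟹ the SUM is a class of `ββ'`;
* `isTwistedKummerClass_zero_one` — `0` is a class of `1`;
* `isTwistedKummerClass_levelRed` — the reduction `levelRed … k 1` (coefficients `ζ ↦ ζ^p`) of a class of `β` at depth `k+1` is a class of `β^p`
  at depth `k` (so Kummer_{k+1}(u) ↦ Kummer_k(u): `(β^p)^{p^k} = β^{p^{k+1}} = u`).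

References: J. Johnson-Leung, G. Kings (2011) §3.3 (5)–(6); K. Kato, Astérisque 295 (2004) §8.2.
-/

noncomputable section

-- the summit namespace `Summit.BirchSwinnertonDyer.BirchSwinnertonDyer` repeats the problem name by design (D-0017)
set_option linter.dupNamespace false
set_option autoImplicit false

open scoped NumberField
open Field IsDedekindDomain
open Literature.NumberTheory.GaloisRepresentations Literature.NumberTheory.GaloisRepresentations.DiscreteGaloisModule
open Literature.NumberTheory.ComplexMultiplication.EllipticUnits.JohnsonLeungKings2011

namespace Summit.BirchSwinnertonDyer.BirchSwinnertonDyer.Theorems.PrintCf2.RowTwo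

variable {K : Type} [Field K] [NumberField K] (p : ℕ) [Fact p.Prime] (S : Set (HeightOneSpectrum (𝓞 K)))
  (θ : absoluteGaloisGroup K →ₜ* ℤ_[p]ˣ) (U : Subgroup (absoluteGaloisGroup K)) (k : ℕ)

omit [NumberField K] in
/-- **Multiplicativity**: a class of `β` plus a class of `β'` is a class of `ββ'`. [cite: JohnsonLeungKings2011, §3.3 (5)–(6) (arXiv p0010:L61–70)] -/
theorem isTwistedKummerClass_mul {β β' : (AlgebraicClosure K)ˣ} {c c' : levelCoh p S θ U k 1}
    (hc : IsTwistedKummerClass p θ S U k β c) (hc' : IsTwistedKummerClass p θ S U k β' c') :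
    IsTwistedKummerClass p θ S U k (β * β') (c + c') := by
  obtain ⟨φ, rfl, hφ⟩ := hc
  obtain ⟨φ', rfl, hφ'⟩ := hc'
  refine ⟨φ + φ', oneCocycleClass_add _ φ φ', fun σ hσ ↦ ?_⟩
  change muVal K (p ^ k) (((φ.1 + φ'.1) ⟨toUnramifiedQuot K S σ, Subgroup.mem_map_of_mem _ hσ⟩ :
      Representation.invariants ((muTwist p θ k).toRepresentation.comp (ramificationSubgroup K S).subtype)) :
        MuCarrier K (p ^ k)) = _
  rw [ContinuousMap.add_apply, Submodule.coe_add, muVal_add, hφ σ hσ, hφ' σ hσ, smul_mul', mul_div_mul_comm]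

omit [NumberField K] in
/-- `0` is a class of `β = 1`. [cite: JohnsonLeungKings2011, §3.3 (5)–(6) (arXiv p0010:L61–70)] -/
theorem isTwistedKummerClass_zero_one : IsTwistedKummerClass p θ S U k 1 (0 : levelCoh p S θ U k 1) := by
  refine ⟨0, ?_, fun σ hσ ↦ ?_⟩
  · exact (map_zero (oneCocycleClassₗ (levelRep p S θ U k).toTopRep))
  · change muVal K (p ^ k) (((0 : C(imGS S U, _)) ⟨toUnramifiedQuot K S σ, Subgroup.mem_map_of_mem _ hσ⟩ :
        Representation.invariants ((muTwist p θ k).toRepresentation.comp (ramificationSubgroup K S).subtype)) :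
          MuCarrier K (p ^ k)) = _
    rw [ContinuousMap.zero_apply, Submodule.coe_zero, muVal_zero, smul_one, div_one]

omit [NumberField K] in
/-- **Reduction law**: `levelRed … k 1` (coefficients `ζ ↦ ζ^p`) sends a class of `β` at depth `k+1` to a class of `β^p` at depth `k` — i.e.
`Kummer_{k+1}(u) ↦ Kummer_k(u)` for `u = β^{p^{k+1}} = (β^p)^{p^k}`. [cite: Kato2004Asterisque, §8.2 (p. 180)] [cite: JohnsonLeungKings2011, §3.3 (5)–(6)] -/
theorem isTwistedKummerClass_levelRed {β : (AlgebraicClosure K)ˣ} {c : levelCoh p S θ U (k + 1) 1}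
    (hc : IsTwistedKummerClass p θ S U (k + 1) β c) :
    IsTwistedKummerClass p θ S U k (β ^ p) (levelRed p S θ U k 1 c) := by
  obtain ⟨φ, rfl, hφ⟩ := hc
  refine ⟨contOneCocycles.pullback (ContinuousMonoidHom.id _) (levelRedHom p S θ U k) φ, ?_, fun σ hσ ↦ ?_⟩
  · rw [levelRed_apply, map_oneCocycleClass]
  · change muVal K (p ^ k) ((coeffRed p S θ k (φ.1 ⟨toUnramifiedQuot K S σ, Subgroup.mem_map_of_mem _ hσ⟩) :
        Representation.invariants ((muTwist p θ k).toRepresentation.comp (ramificationSubgroup K S).subtype)) :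
          MuCarrier K (p ^ k)) = _
    rw [coe_coeffRed, muVal_muPowMap, hφ σ hσ, pow_succ, Nat.mul_div_cancel_left p (pow_pos (Fact.out : p.Prime).pos k),
      div_pow, smul_pow']

end Summit.BirchSwinnertonDyer.BirchSwinnertonDyer.Theorems.PrintCf2.RowTwo

end
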